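import Mathlib

/-!
# Sketch 2 — crux-ideate stmt-FinalStateConjecture-13550 (`StarvedNecks.HonestFixedRadiusSettling`),
# round 1, ideator 1: first lemma of the idea `sojourn-needs-only-one-over-delta`

Christodoulou's sojourn form of complete `𝓘⁺` (`HasCompleteFutureNullInfinity`, NullInfinity.lean)
asks only for a LOWER bound `≥ s` on the affine time a far normalised null ray spends in `J⁺(ι B₀)`.
Along a ray crossing the certified radiation zone, rate-free `C¹` control `|Γ| ≤ δ` of the pulled
back metric gives for the time component `f = dt/dλ` of the tangent only `f' ≤ C δ f` in coordinate
time (exponential degradation of the affine normalisation, the gap recorded on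
`SettleThenCensor.SettlingCertifiesCensorship`: "Grönwall gives only if sup|∂g̃| = O(1/t)").  The
lemma below says this is harmless for a lower bound: the affine time accrued over coordinate time
`T` is `∫₀ᵀ dt / f ≥ (1 − e^{−δT})/δ`, which tends to `1/δ → ∞` as the (rate-free) deviation
`δ = δ(τ) → 0`.
-/

namespace Summit.FinalStateConjecture.FinalStateConjecture.Cruxes.HonestFixedRadiusSettling.OneOverDelta

open Filter Topology Set MeasureTheory intervalIntegral
open scoped ContDiff

/-- **First lemma (affine sojourn under exponential degradation).** If `f > 0`, `f(0) = 1` and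
`f' ≤ δ f` on `t ≥ 0` (`δ > 0`), then `∫₀ᵀ f(t)⁻¹ dt ≥ (1 − e^{−δT})/δ` for every `T ≥ 0`. -/
def AffineSojournLowerBound : Prop :=
  ∀ (δ T : ℝ), 0 < δ → 0 ≤ T → ∀ f : ℝ → ℝ, Differentiable ℝ f → f 0 = 1 → (∀ t, 0 < f t) →
    (∀ t, 0 ≤ t → deriv f t ≤ δ * f t) →
    (1 - Real.exp (-(δ * T))) / δ ≤ ∫ t in (0:ℝ)..T, (f t)⁻¹

/-- The elementary integral `∫₀ᵀ e^{−δt} dt = (1 − e^{−δT})/δ`. -/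
lemma integral_exp_neg_mul (δ T : ℝ) (hδ : δ ≠ 0) :
    ∫ t in (0:ℝ)..T, Real.exp (-(δ * t)) = (1 - Real.exp (-(δ * T))) / δ := by
  have h1 : (fun t : ℝ ↦ Real.exp (-(δ * t))) = fun t ↦ Real.exp ((-δ) * t) := by
    ext t; ring_nf
  rw [h1, intervalIntegral.integral_comp_mul_left (fun x ↦ Real.exp x) (neg_ne_zero.mpr hδ),
    integral_exp]
  simp only [mul_zero, Real.exp_zero, smul_eq_mul]
  field_simp
  ring

/-- Grönwall half: `f ≤ e^{δt}` on `t ≥ 0`. -/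
lemma le_exp_of_deriv_le (δ : ℝ) (f : ℝ → ℝ) (hf : Differentiable ℝ f) (hf0 : f 0 = 1)
    (hgr : ∀ t, 0 ≤ t → deriv f t ≤ δ * f t) : ∀ t, 0 ≤ t → f t ≤ Real.exp (δ * t) := by
  -- g t := e^{-δ t} f t is antitone on [0, ∞)
  set g : ℝ → ℝ := fun t ↦ Real.exp (-(δ * t)) * f t with hg
  have hgd : Differentiable ℝ g := by
    apply Differentiable.mul _ hf
    exact Real.differentiable_exp.comp ((differentiable_const δ).mul differentiable_id).neg
  have hderiv : ∀ t, deriv g t = Real.exp (-(δ * t)) * (deriv f t - δ * f t) := by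
    intro t
    have h₁ : HasDerivAt (fun t : ℝ ↦ -(δ * t)) (-δ) t := by
      have h := ((hasDerivAt_id t).const_mul δ).neg
      rw [mul_one] at h
      apply h.congr_of_eventuallyEq
      exact Eventually.of_forall fun y ↦ by simp
    have h₂ : HasDerivAt (fun t : ℝ ↦ Real.exp (-(δ * t))) (Real.exp (-(δ * t)) * (-δ)) t :=
      (Real.hasDerivAt_exp _).comp t h₁
    have h₃ : HasDerivAt f (deriv f t) t := (hf t).hasDerivAt
    have := h₂.mul h₃
    have h4 : HasDerivAt g (Real.exp (-(δ * t)) * -δ * f t + Real.exp (-(δ * t)) * deriv f t) t := by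
      apply this.congr_of_eventuallyEq
      exact Eventually.of_forall fun y ↦ by simp [hg]
    rw [h4.deriv]
    ring
  have hanti : AntitoneOn g (Ici 0) := by
    apply antitoneOn_of_deriv_nonpos (convex_Ici 0) hgd.continuous.continuousOn
      (hgd.differentiableOn.mono interior_subset)
    intro t ht
    rw [interior_Ici] at ht
    rw [hderiv]
    have := hgr t (le_of_lt ht)
    have hpos : 0 < Real.exp (-(δ * t)) := Real.exp_pos _
    nlinarith
  intro t ht
  have hgt : g t ≤ g 0 := hanti (self_mem_Ici) (mem_Ici.mpr ht) ht
  have hg0 : g 0 = 1 := by simp [hg, hf0]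
  rw [hg0] at hgt
  have key : Real.exp (δ * t) * (Real.exp (-(δ * t)) * f t) ≤ Real.exp (δ * t) * 1 :=
    mul_le_mul_of_nonneg_left hgt (Real.exp_pos _).le
  have hexp : Real.exp (δ * t) * Real.exp (-(δ * t)) = 1 := by
    rw [← Real.exp_add]; simp
  calc f t = Real.exp (δ * t) * Real.exp (-(δ * t)) * f t := by rw [hexp, one_mul]
    _ = Real.exp (δ * t) * (Real.exp (-(δ * t)) * f t) := by ring
    _ ≤ Real.exp (δ * t) * 1 := key
    _ = Real.exp (δ * t) := mul_one _

/-- **The first lemma holds** (Grönwall + monotonicity of the interval integral). -/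
theorem affineSojournLowerBound_holds : AffineSojournLowerBound := by
  intro δ T hδ hT f hf hf0 hpos hgr
  have hle : ∀ t ∈ Icc 0 T, Real.exp (-(δ * t)) ≤ (f t)⁻¹ := by
    intro t ht
    have h1 := le_exp_of_deriv_le δ f hf hf0 hgr t ht.1
    have : (Real.exp (δ * t))⁻¹ ≤ (f t)⁻¹ := inv_anti₀ (hpos t) h1
    simpa [Real.exp_neg] using this
  rw [← integral_exp_neg_mul δ T hδ.ne']
  apply intervalIntegral.integral_mono_on hT ?_ ?_ hle
  · exact (Real.continuous_exp.comp (continuous_const.mul continuous_id).neg).intervalIntegrable _ _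
  · apply Continuous.intervalIntegrable
    exact Continuous.inv₀ hf.continuous (fun t ↦ (hpos t).ne')

/-- **Corollary shape used by the line** (stated, provable from the above): with entry
normalisation `f(0) ≤ L₀` instead of `= 1` the bound reads `≥ (1 − e^{−δT})/(δ L₀)`; as the
certified deviation `δ(τ) → 0` along later and later entry times and the available coordinate time
`T(τ) → ∞` (sublinear tubes), the accrued affine sojourn tends to `∞` — the `∀ s ∃ B₁` clause of
`HasCompleteFutureNullInfinity`. -/
def SojournDiverges : Prop :=
  ∀ (δ T : ℕ → ℝ) (L₀ : ℝ), 0 < L₀ → (∀ n, 0 < δ n) → Tendsto δ atTop (𝓝 0) →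
    Tendsto (fun n ↦ δ n * T n) atTop atTop →
    Tendsto (fun n ↦ (1 - Real.exp (-(δ n * T n))) / (δ n * L₀)) atTop atTop

end Summit.FinalStateConjecture.FinalStateConjecture.Cruxes.HonestFixedRadiusSettling.OneOverDelta
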